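import Summits.Ventures.CertifiedManyBodySolver.Theorems.TcThermcert1GcGibbsFactorization
import Mathlib
import HarnessLib

/-!
# Local traces of the two-fugacity Gibbs factor: sub-box atomic value, two-fold factorisation, ratio of local traces
# (K2 groundwork, part 6)

Helper file for route `TcThermcert1`, crux `ThermalStiffnessCeilingU8b10_le_1o8` (item `stmt-Ventures-26381`), line
`Cruxes/ThermalStiffnessCeilingU8b10_le_1o8/Lines/zerofree_corridor.lean` v9, registered stub K2 `stub_gcHighTempAnalytic`, step S4 of
`Cruxes/…/STUB-PLAN-stub_gcHighTempAnalytic.md` (locality of the normalised factor — the exact identities behind the activity bound).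

For the two-fugacity local exponent `W_A = −β V_A(U,0) + F_A(z,w)`, `F_A(z,w) = Σ_{x∈A} (log z · n_{x↑} + log w · n_{x↓})` (part 3):
* §1 `F_A` is diagonal in the occupation basis (`sum_logFugacity_eq_diagonal`) and its exponential entry is the product of the one-site
  fugacity factors (`cexp_sum_logFugacityAt`);
* §2 **partial two-fugacity atomic trace** `tr_Λ exp(W_A) = z₂^{|A|} · 4^{|Λ|−|A|}`, `z₂ = 1 + z + w + z w e^{−βU}`, for `z, w ≠ 0`
  (`trace_exp_twoFugacityLocal`; pattern of the tree's `trace_exp_neg_onSiteSum`, one-site table `(1, z, w, z w e^{−βU})`);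
* §3 **two-fold factorisation** `T(c) · 2^{|Orb Λ|} = tr exp(W_A + Σ_b c_b T_b) · tr exp(W_{Aᶜ})` for couplings on bonds inside `A` and any
  `T` agreeing with the two-fugacity Gibbs factor (`twoFugacity_mul_two_pow`, pattern of `HubbardPolymerBounds.Zc_mul_two_pow`), and
  **the normalised factor as a ratio of local traces** `T(c)/T(0) = tr exp(W_A + Σ c T) / tr exp(W_A)` when `z₂ ≠ 0`
  (`twoFugacity_ratio_eq_div`, pattern of `gibbsRatio_eq_div`).

[cite: Ueltschi1999, §2.1 (factorization property), §2.3 (ρ(𝒜) only involves the sites of 𝒜)] Finite-dimensional linear algebra; no physics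
claim — nothing about superconductivity in the Hubbard model is proved by anything in this file. No definitions; no `sorry`.
-/

noncomputable section

namespace Summit.Ventures.CertifiedManyBodySolver.Theorems.TcThermcert1.ZeroFreeCorridor

open Matrix Finset Complex
open Literature.MathematicalPhysics.QuantumLattice

variable {Λ : Type*} [LinearOrder Λ] [Fintype Λ]

/-! ## §1 `F_A` in the occupation basis -/

/-- `F_A(z,w)` is diagonal: its entry at the configuration `s` is `Σ_{x∈A} ([x↑ ∈ s] log z + [x↓ ∈ s] log w)`. -/
theorem sum_logFugacity_eq_diagonal (z w : ℂ) (A : Finset Λ) :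
    (∑ x ∈ A, (Complex.log z • numberOp x 0 + Complex.log w • numberOp x 1)) =
      diagonal (fun s : Finset (Orb Λ) =>
        ∑ x ∈ A, ((if orb x 0 ∈ s then Complex.log z else 0) + (if orb x 1 ∈ s then Complex.log w else 0))) := by
  have hn : ∀ (x : Λ) (σ : Fin 2),
      numberOp x σ = diagonal (fun s : Finset (Orb Λ) => if orb x σ ∈ s then (1 : ℂ) else 0) := fun x σ => by
    rw [← numberAt_orb, numberAt_eq_diagonal]
  ext s t
  simp only [Matrix.sum_apply, Matrix.add_apply, Matrix.smul_apply, hn, diagonal_apply, smul_eq_mul]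
  by_cases hst : s = t
  · subst hst
    simp only [if_true, mul_ite, mul_one, mul_zero]
  · simp [hst]

omit [Fintype Λ] in
/-- The exponential of the entry of `F_A`: `exp(Σ_{x∈A} ([x↑∈s] log z + [x↓∈s] log w)) = Π_x [x ∈ A → z^{[x↑∈s]} w^{[x↓∈s]}]`
for `z, w ≠ 0`. -/
theorem cexp_sum_logFugacityAt [DecidableEq Λ] {z w : ℂ} (hz : z ≠ 0) (hw : w ≠ 0) (A : Finset Λ) [Fintype Λ]
    (s : Finset (Orb Λ)) :
    cexp (∑ x ∈ A, ((if orb x 0 ∈ s then Complex.log z else 0) + (if orb x 1 ∈ s then Complex.log w else 0))) =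
      ∏ x, if x ∈ A then (if x ∈ upPart s then z else 1) * (if x ∈ downPart s then w else 1) else 1 := by
  rw [Complex.exp_sum, ← Finset.prod_filter, Finset.filter_mem_eq_inter, Finset.univ_inter]
  refine Finset.prod_congr rfl fun x _ => ?_
  rw [Complex.exp_add]
  simp only [mem_upPart, mem_downPart]
  congr 1
  · split_ifs <;> simp [Complex.exp_log hz]
  · split_ifs <;> simp [Complex.exp_log hw]

/-! ## §2 The partial two-fugacity atomic trace -/

/-- **Partial two-fugacity atomic trace**: over the Fock space of `Λ`, for `z, w ≠ 0`,
`tr exp(−β V_A(U,0) + F_A(z,w)) = (1 + z + w + z w e^{−βU})^{|A|} · 4^{|Λ| − |A|}`. -/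
theorem trace_exp_twoFugacityLocal {z w : ℂ} (β U : ℂ) (hz : z ≠ 0) (hw : w ≠ 0) (A : Finset Λ) :
    (NormedSpace.exp (-(β • onSiteSum U 0 A) +
        ∑ x ∈ A, (Complex.log z • numberOp x 0 + Complex.log w • numberOp x 1))).trace =
      (1 + z + w + z * w * cexp (-(β * U))) ^ A.card * 4 ^ (Fintype.card Λ - A.card) := by
  classical
  rw [onSiteSum_eq_diagonal, sum_logFugacity_eq_diagonal,
    show (-(β • diagonal fun s : Finset (Orb Λ) => ∑ x ∈ A, onSiteEnergyAt U 0 x s)) =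
      diagonal (fun s => -(β * ∑ x ∈ A, onSiteEnergyAt U 0 x s)) by rw [← diagonal_smul, ← diagonal_neg]; rfl,
    diagonal_add, Matrix.exp_diagonal, trace_diagonal]
  simp only [Pi.exp_def, ← Complex.exp_eq_exp_ℂ]
  simp_rw [Complex.exp_add, exp_neg_sum_onSiteEnergyAt, cexp_sum_logFugacityAt hz hw, ← Finset.prod_mul_distrib]
  -- one factorised weight per site
  set φ : Λ → Bool → Bool → ℂ := fun x b b' => if x ∈ A then
      atomicBoltzmannTable β U 0 b b' * ((if b = true then z else 1) * (if b' = true then w else 1)) else 1 with hφ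
  have hterm : ∀ s : Finset (Orb Λ), (∏ x, (if x ∈ A then
      atomicBoltzmannTable β U 0 (decide (x ∈ upPart s)) (decide (x ∈ downPart s)) else 1) *
        (if x ∈ A then (if x ∈ upPart s then z else 1) * (if x ∈ downPart s then w else 1) else 1)) =
      ∏ x, φ x (decide (x ∈ upPart s)) (decide (x ∈ downPart s)) := by
    intro s
    refine Finset.prod_congr rfl fun x _ => ?_
    simp only [hφ, decide_eq_true_eq]
    split_ifs <;> simp
  simp_rw [hterm]
  have h1 : (∑ s : Finset (Orb Λ), ∏ x, φ x (decide (x ∈ upPart s)) (decide (x ∈ downPart s))) =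
      ∑ p : Finset Λ × Finset Λ, ∏ x, φ x (decide (x ∈ upPart (configEquiv.symm p))) (decide (x ∈ downPart (configEquiv.symm p))) :=
    (configEquiv.symm.sum_comp _).symm
  rw [h1, Fintype.sum_prod_type]
  simp only [configEquiv, Equiv.coe_fn_symm_mk, upPart_pairSet, downPart_pairSet]
  rw [sum_sum_prod_eq_prod φ]
  have hsite : ∀ x : Λ, (φ x true true + φ x true false + φ x false true + φ x false false) =
      if x ∈ A then 1 + z + w + z * w * cexp (-(β * U)) else 4 := by
    intro x
    by_cases hx : x ∈ A
    · simp only [hφ, if_pos hx, atomicBoltzmannTable, if_true, Bool.false_eq_true, if_false, mul_zero, sub_zero,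
        Complex.exp_zero, mul_one, one_mul]
      ring
    · simp only [hφ, if_neg hx]; norm_num
  rw [Finset.prod_congr rfl fun x _ => hsite x, Finset.prod_ite, Finset.prod_const, Finset.prod_const,
    Finset.filter_mem_eq_inter, Finset.univ_inter]
  congr 2
  rw [Finset.filter_not, Finset.filter_mem_eq_inter, Finset.univ_inter, Finset.card_univ_sdiff]

/-- The partial two-fugacity atomic trace is non-zero when `z₂ ≠ 0`. -/
theorem trace_exp_twoFugacityLocal_ne_zero {z w : ℂ} (β U : ℂ) (hz : z ≠ 0) (hw : w ≠ 0)
    (h2 : 1 + z + w + z * w * cexp (-(β * U)) ≠ 0) (A : Finset Λ) :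
    (NormedSpace.exp (-(β • onSiteSum U 0 A) +
        ∑ x ∈ A, (Complex.log z • numberOp x 0 + Complex.log w • numberOp x 1))).trace ≠ 0 := by
  rw [trace_exp_twoFugacityLocal β U hz hw A]
  exact mul_ne_zero (pow_ne_zero _ h2) (pow_ne_zero _ (by norm_num))

/-! ## §3 Two-fold factorisation and the ratio of local traces -/

/-- `F_Λ = F_A + F_{Aᶜ}`. -/
theorem sum_logFugacity_univ_eq_add_compl (z w : ℂ) (A : Finset Λ) :
    (∑ x ∈ (univ : Finset Λ), (Complex.log z • numberOp x 0 + Complex.log w • numberOp x 1)) =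
      (∑ x ∈ A, (Complex.log z • numberOp x 0 + Complex.log w • numberOp x 1)) +
        ∑ x ∈ Aᶜ, (Complex.log z • numberOp x 0 + Complex.log w • numberOp x 1) := by
  rw [← Finset.union_compl A, Finset.sum_union disjoint_compl_right]

/-- **Two-fold factorisation**: for couplings on bonds inside `A` and `T` agreeing with the two-fugacity Gibbs factor,
`T(c) · 2^{|Orb Λ|} = tr exp(W_A + Σ_b c_b T_b) · tr exp(W_{Aᶜ})`, `W_A = −β V_A(U,0) + F_A(z,w)`. -/
theorem twoFugacity_mul_two_pow (β U z w : ℂ) (T : (Bond Λ → ℂ) → ℂ)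
    (hT : ∀ c, T c = (NormedSpace.exp (-(β • onSiteSum U 0 (univ : Finset Λ)) +
      (∑ x ∈ (univ : Finset Λ), (Complex.log z • numberOp x 0 + Complex.log w • numberOp x 1)) + hopSum c)).trace)
    {A : Finset Λ} {c : Bond Λ → ℂ} (hc : ∀ b, c b ≠ 0 → b.1 ∈ A ∧ b.2.1 ∈ A) :
    T c * 2 ^ Fintype.card (Orb Λ) =
      (NormedSpace.exp (-(β • onSiteSum U 0 A) + (∑ x ∈ A, (Complex.log z • numberOp x 0 + Complex.log w • numberOp x 1)) +
          hopSum c)).trace *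
        (NormedSpace.exp (-(β • onSiteSum U 0 Aᶜ) +
          ∑ x ∈ Aᶜ, (Complex.log z • numberOp x 0 + Complex.log w • numberOp x 1))).trace := by
  have hV : onSiteSum U 0 (Finset.univ : Finset Λ) = onSiteSum U 0 A + onSiteSum U 0 Aᶜ := by
    rw [← Finset.union_compl A, onSiteSum_union U 0 disjoint_compl_right]
  have hexp : -(β • onSiteSum U 0 (Finset.univ : Finset Λ)) +
      (∑ x ∈ (univ : Finset Λ), (Complex.log z • numberOp x 0 + Complex.log w • numberOp x 1)) + hopSum c =
      (-(β • onSiteSum U 0 A) + (∑ x ∈ A, (Complex.log z • numberOp x 0 + Complex.log w • numberOp x 1)) + hopSum c) +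
        (-(β • onSiteSum U 0 Aᶜ) + ∑ x ∈ Aᶜ, (Complex.log z • numberOp x 0 + Complex.log w • numberOp x 1)) := by
    rw [hV, sum_logFugacity_univ_eq_add_compl z w A, smul_add, neg_add]; abel
  have m1 : -(β • onSiteSum U 0 A) + (∑ x ∈ A, (Complex.log z • numberOp x 0 + Complex.log w • numberOp x 1)) + hopSum c ∈
      carEvenSubalgebra (orbs A) := Subalgebra.add_mem _ (twoFugacityLocal_mem β U z w subset_rfl) (hopSum_mem hc)
  have m3 : -(β • onSiteSum U 0 Aᶜ) + (∑ x ∈ Aᶜ, (Complex.log z • numberOp x 0 + Complex.log w • numberOp x 1)) ∈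
      carEvenSubalgebra (orbs Aᶜ) := twoFugacityLocal_mem β U z w subset_rfl
  have hd : Disjoint (orbs A) (orbs Aᶜ) := disjoint_orbs disjoint_compl_right
  have hcomm := commute_of_mem_carEvenSubalgebra m1 (carEvenSubalgebra_le_carSubalgebra _ m3) hd
  rw [hT, hexp, Matrix.exp_add_of_commute _ _ hcomm]
  exact trace_mul_of_mem_carSubalgebra (exp_mem_subalgebra _ (carEvenSubalgebra_le_carSubalgebra _ m1))
    (exp_mem_subalgebra _ (carEvenSubalgebra_le_carSubalgebra _ m3)) hd

/-- **The normalised two-fugacity factor is a ratio of local traces**: for couplings on bonds inside `A`, `z, w ≠ 0` and `z₂ ≠ 0`,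
`T(c)/T(0) = tr exp(W_A + Σ_b c_b T_b) / tr exp(W_A)`. -/
theorem twoFugacity_ratio_eq_div {β U z w : ℂ} (hz : z ≠ 0) (hw : w ≠ 0) (h2 : 1 + z + w + z * w * cexp (-(β * U)) ≠ 0)
    (T : (Bond Λ → ℂ) → ℂ)
    (hT : ∀ c, T c = (NormedSpace.exp (-(β • onSiteSum U 0 (univ : Finset Λ)) +
      (∑ x ∈ (univ : Finset Λ), (Complex.log z • numberOp x 0 + Complex.log w • numberOp x 1)) + hopSum c)).trace)
    {A : Finset Λ} {c : Bond Λ → ℂ} (hc : ∀ b, c b ≠ 0 → b.1 ∈ A ∧ b.2.1 ∈ A) :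
    T c / T 0 =
      (NormedSpace.exp (-(β • onSiteSum U 0 A) + (∑ x ∈ A, (Complex.log z • numberOp x 0 + Complex.log w • numberOp x 1)) +
          hopSum c)).trace /
        (NormedSpace.exp (-(β • onSiteSum U 0 A) +
          ∑ x ∈ A, (Complex.log z • numberOp x 0 + Complex.log w • numberOp x 1))).trace := by
  have h1 := twoFugacity_mul_two_pow β U z w T hT hc
  have h0 := twoFugacity_mul_two_pow β U z w T hT (A := A) (c := 0) (fun b hb => absurd rfl hb)
  rw [hopSum_zero, add_zero] at h0
  have hN : (2 : ℂ) ^ Fintype.card (Orb Λ) ≠ 0 := pow_ne_zero _ two_ne_zero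
  have hτ₃ := trace_exp_twoFugacityLocal_ne_zero β U hz hw h2 Aᶜ
  have hA := trace_exp_twoFugacityLocal_ne_zero β U hz hw h2 A
  have hZ0 : T 0 ≠ 0 := by
    rw [hT, hopSum_zero, add_zero, trace_exp_twoFugacityLocal β U hz hw, Finset.card_univ, Nat.sub_self, pow_zero, mul_one]
    exact pow_ne_zero _ h2
  rw [div_eq_div_iff hZ0 hA]
  apply mul_right_cancel₀ (mul_ne_zero hN hτ₃)
  set X : ℂ := (NormedSpace.exp (-(β • onSiteSum U 0 A) +
      (∑ x ∈ A, (Complex.log z • numberOp x 0 + Complex.log w • numberOp x 1)) + hopSum c)).trace with hX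
  set Y : ℂ := (NormedSpace.exp (-(β • onSiteSum U 0 A) +
      ∑ x ∈ A, (Complex.log z • numberOp x 0 + Complex.log w • numberOp x 1))).trace with hY
  set R : ℂ := (NormedSpace.exp (-(β • onSiteSum U 0 Aᶜ) +
      ∑ x ∈ Aᶜ, (Complex.log z • numberOp x 0 + Complex.log w • numberOp x 1))).trace with hR
  calc T c * Y * (2 ^ Fintype.card (Orb Λ) * R) = (T c * 2 ^ Fintype.card (Orb Λ)) * (Y * R) := by ring
    _ = (X * R) * (T 0 * 2 ^ Fintype.card (Orb Λ)) := by rw [h1, h0]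
    _ = X * T 0 * (2 ^ Fintype.card (Orb Λ) * R) := by ring

end Summit.Ventures.CertifiedManyBodySolver.Theorems.TcThermcert1.ZeroFreeCorridor

end
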